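import Summits.Ventures.PackingBounds.SphericalCodes.TenTenth
import Literature.Geometry.DiscreteGeometry.ThreePointKernelGeneral

/-!
# `A(10, arccos 1/10) ≤ 26` from an exact value-`27` three-point certificate — Gegenbauer form of the master implication

Framing: lottery ticket; floor = certified bounds/negative ranges. Venture `PackingBounds` (cell
`pub-packcert`, recognition seat, T5.md §5/§9).

`TenTenth.card_le_26_of_tight_certificate` consumes an abstract Bachoc–Vallentin certificate at
`s = 1/10` on `ℝ¹⁰` whose two-point part is written `A' + a₁·u + a₂·(10u² − 1)`.  The kernel checker of
exact (slack-free) three-point certificates (`ThreePointCert.CheckExact`, soundness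
`ThreePointCert.SoundExactChecks`) delivers the two-point part instead as a nonnegative Gegenbauer
combination `A(u) = Σ_{k ≤ deg} a_k C_k^{(4)}(u)` (parameter `(n − 2)/2 = 4` for `n = 10`) with `B = 0`,
together with the facts `A(u) + 3F(u,u,1) ≤ −1` on `[−1, 1/10]` (equality only on the zero set of a data
polynomial), `F ≤ 0` on the admissible region, three-point positivity and symmetry of `F`, and the exact
value `1 + A(1) + F(1,1,1) = 27`.  This file is the adapter between the two: since `C_1^{(4)}(u) = 8u`
and `C_2^{(4)}(u) = 4(10u² − 1)`, a certificate in Gegenbauer form with `a_1, a_2 > 0` and slack zero set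
`⊆ {1/10, −1/2}` satisfies the hypotheses of the master implication with `A' = Σ_{k ∉ {1,2}} a_k C_k^{(4)}`,
`a₁ = 8a_1`, `a₂ = 4a_2`, `b = 0`; hence every spherical code in `ℝ¹⁰` with pairwise inner products
`≤ 1/10` has at most `26` points (`card_le_26_of_exact27_certificate`).  What then remains for the
unconditional theorem is only the kernel instance of the exact certificate (T5.md §9 (K3)/(K4)).
-/

noncomputable section

open Finset
open scoped RealInnerProductSpace BigOperators

namespace Summit.Ventures.PackingBounds.SphericalCodes

open Literature.Geometry.DiscreteGeometry Literature.Geometry.DiscreteGeometry.BachocVallentin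
open Literature.Analysis.SpecialFunctions

/-- `C_1^{(4)}(s) = 8s` (the Gegenbauer polynomial of parameter `4 = (10 − 2)/2`, degree `1`). -/
theorem gegenbauerSum_four_one (s : ℝ) : gegenbauerSum 4 1 s = 8 * s := by
  rw [gegenbauerSum_one]; ring

/-- `C_2^{(4)}(s) = 40s² − 4 = 4(10s² − 1)`. -/
theorem gegenbauerSum_four_two (s : ℝ) : gegenbauerSum 4 2 s = 40 * s ^ 2 - 4 := by
  simp only [gegenbauerSum, gegenbauerCoeff]
  norm_num [Finset.sum_range_succ, Finset.prod_range_succ, Nat.factorial]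
  ring

/-- **`A(10, arccos 1/10) ≤ 26` from an exact value-`27` certificate in Gegenbauer form (`B = 0`).**
Let `A(u) = Σ_{k ≤ deg} a_k C_k^{(4)}(u)` with all `a_k ≥ 0` and `a_1, a_2 > 0`, and let `F` be symmetric
with nonnegative three-point sums over every finite family of unit vectors of `ℝ¹⁰`.  If
`A(u) + 3F(u,u,1) ≤ −1` on `[−1, 1/10]` with equality only for `u ∈ {1/10, −1/2}`, `F ≤ 0` on the
admissible part of `[−1, 1/10]³`, and `1 + A(1) + F(1,1,1) = 27` exactly, then every finite set of unit
vectors of `ℝ¹⁰` with pairwise inner products `≤ 1/10` has at most `26` elements.  (Reduction to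
`card_le_26_of_tight_certificate` with `A' = Σ_{k ∉ {1,2}} a_k C_k^{(4)}`, `a₁ = 8a_1`, `a₂ = 4a_2`,
`b₁₁ = b₁₂ = b₂₂ = 0`.) -/
theorem card_le_26_of_exact27_certificate
    (deg : ℕ) (hdeg : 2 ≤ deg) (a : ℕ → ℝ) (ha : ∀ k, 0 ≤ a k) (ha1 : 0 < a 1) (ha2 : 0 < a 2)
    (A : ℝ → ℝ) (hA : ∀ t, A t = ∑ k ∈ range (deg + 1), a k * gegenbauerSum 4 k t)
    (F : ℝ → ℝ → ℝ → ℝ)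
    (hF : ∀ D : Finset (EuclideanSpace ℝ (Fin 10)), (∀ x ∈ D, ‖x‖ = 1) → 0 ≤ tripleSum D F)
    (hF12 : ∀ u v t, F u v t = F v u t) (hF23 : ∀ u v t, F u v t = F u t v)
    (h1 : ∀ u : ℝ, -1 ≤ u → u ≤ 1 / 10 → A u + 3 * F u u 1 ≤ -1)
    (h2 : ∀ u v t : ℝ, -1 ≤ u → u ≤ 1 / 10 → -1 ≤ v → v ≤ 1 / 10 → -1 ≤ t → t ≤ 1 / 10 →
      0 ≤ 1 + 2 * u * v * t - u ^ 2 - v ^ 2 - t ^ 2 → F u v t ≤ 0)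
    (hval : 1 + A 1 + F 1 1 1 = 27)
    (hzero : ∀ u : ℝ, -1 ≤ u → u ≤ 1 / 10 → A u + 3 * F u u 1 = -1 → u = 1 / 10 ∨ u = -1 / 2)
    (C : Finset (EuclideanSpace ℝ (Fin 10))) (hC : ∀ x ∈ C, ‖x‖ = 1)
    (hcode : ∀ x ∈ C, ∀ y ∈ C, x ≠ y → inner ℝ x y ≤ 1 / 10) : C.card ≤ 26 := by
  classical
  -- the two-point part without its degree-1 and degree-2 terms
  let a' : ℕ → ℝ := fun k => if k = 1 then 0 else if k = 2 then 0 else a k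
  let A' : ℝ → ℝ := fun t => ∑ k ∈ range (deg + 1), a' k * gegenbauerSum 4 k t
  have ha' : ∀ k, 0 ≤ a' k := by
    intro k
    by_cases hk1 : k = 1
    · simp [a', hk1]
    · by_cases hk2 : k = 2
      · simp [a', hk2]
      · simp only [a', hk1, hk2, if_false]; exact ha k
  have h10 : (3 : ℕ) ≤ 10 := by norm_num
  have hμ : (((10 : ℕ) : ℝ) - 2) / 2 = 4 := by norm_num
  have hA'nn : ∀ D : Finset (EuclideanSpace ℝ (Fin 10)), (∀ x ∈ D, ‖x‖ = 1) → 0 ≤ pairSum D A' := by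
    intro D hD
    have h := pairSum_gegenbauer_comb_nonneg h10 deg a' ha' D hD
    rw [hμ] at h
    exact h
  -- the decomposition `A u = A' u + (8 a_1) u + (4 a_2)(10 u² − 1)`
  have h1mem : 1 ∈ range (deg + 1) := by simp; omega
  have h2mem : 2 ∈ range (deg + 1) := by simp; omega
  have hsplit : ∀ u : ℝ, A u = A' u + (8 * a 1) * u + (4 * a 2) * (10 * u ^ 2 - 1) := by
    intro u
    have hpt : ∀ k ∈ range (deg + 1), a k * gegenbauerSum 4 k u
        = a' k * gegenbauerSum 4 k u + ((if 1 = k then a k * gegenbauerSum 4 k u else 0)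
          + (if 2 = k then a k * gegenbauerSum 4 k u else 0)) := by
      intro k _
      by_cases hk1 : k = 1
      · subst hk1; simp [a']
      · by_cases hk2 : k = 2
        · subst hk2; simp [a']
        · have e1 : ¬ (1 = k) := fun h => hk1 h.symm
          have e2 : ¬ (2 = k) := fun h => hk2 h.symm
          simp [a', hk1, hk2, e1, e2]
    rw [hA u, Finset.sum_congr rfl hpt, Finset.sum_add_distrib, Finset.sum_add_distrib,
      Finset.sum_ite_eq, Finset.sum_ite_eq, if_pos h1mem, if_pos h2mem,
      gegenbauerSum_four_one, gegenbauerSum_four_two]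
    ring
  -- feed the master implication with `b = 0`
  refine card_le_26_of_tight_certificate A' (8 * a 1) (4 * a 2) (by positivity) (by positivity) F 0 0 0
    hA'nn hF hF12 hF23 (fun l => by norm_num) ?_ ?_ ?_ ?_ C hC hcode
  · intro u hu hu'
    have h := h1 u hu hu'
    rw [hsplit u] at h
    linarith
  · intro u v t hu hu' hv hv' ht ht' hp
    have h := h2 u v t hu hu' hv hv' ht ht' hp
    simpa using h
  · have h := hval
    rw [hsplit 1] at h
    linarith
  · intro u hu hu' heq
    refine hzero u hu hu' ?_
    rw [hsplit u]
    linarith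

end Summit.Ventures.PackingBounds.SphericalCodes

end
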